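import Literature.NumberTheory.GelbartRogawski1991.LocalDoubledBlockTypesDuality
import Literature.NumberTheory.GelbartRogawski1991.LocalUnitarySplittingsCM
import HarnessLib

/-!
# The doubling relation (D) in the tree's undoubled currency: `localSplittingCMWith` (Kudla's CM splitting of `U(T₀ ⊗ 1)(L⁺_v)`)
# is the first block, and its types are dual to those of the second block of the doubled datum

Topic `NumberTheory/GelbartRogawski1991`; namespace `Literature.NumberTheory.GelbartRogawski1991.UnitaryDualPair.LocalSplitting`.  KERNEL ONLY:
theorems; no definition, no named fact, no `sorry`, no instance, no notation.  Cell `hodgecm-mathlib` (D-0151), fan B, L1ns road (P) of the crux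
hLiu418 — brick B4 (junction) of the «doubling relation (D)» (memo `F0/P6/B-p04/g44/MEMO-L1ns-road.v3.B-p04g44.md`); `--supports
stmt-HodgeConjecture-24832`, count-neutral.

* §0 (generic `F ⊂ E`, any homomorphism `s` of the doubled group over `ι^𝔻_v`) **`undoubleLoc_eq_restrictLeft`** — the tree's two «first-block
  restrictions» of `s` coincide: ★ `undoubleLoc` (`LocalUnitaryUndoubling`, second block modelled on `−(T₀ ⊗ F_v)`) and ★ `BlockSum.restrictLeft`
  along `T^𝔻 = T₀ ⊕ᶠ (−T₀)` (`LocalUnitaryBlockRestriction`, second block modelled on `(−T₀) ⊗ F_v`): same projection, and the same operator by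
  `⊠`-cancellation against `1_{𝒪^n}` (★ `toRep_undoubleLoc_boxSB`, ★ `BlockSum.toRep_inlLoc_boxSB`, `inlLoc_eq_blockSum_inlLoc`).
* §1 (CM data, ★ `localSplittingCMWith L n hT₀ hT₀d hJ χ hχ v μ = undoubleLoc s^𝔻`) **`nontrivial_coinv_negBlock_of_nontrivial_coinv_localSplittingCMWith`**
  and **`nontrivial_coinv_localSplittingCMWith_of_nontrivial_coinv_negBlock`** — ★ `nontrivial_coinv_right_of_nontrivial_coinv_left` ∕ `…left_of_…right`
  with block 1 spelled `localSplittingCMWith` and its smoothness supplied (★ `isSmooth_localSplittingCMWith`, `φ` continuous): for a compact `A`,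
  `φ : A →* U(T₀⊗1)(L⁺_v)` continuous, characters `η θ` with `η·θ = e ∘ φ` and open kernels,
  `Coinv_η(ω_{T₀} ∘ localSplittingCMWith ∘ φ) ≠ 0 ⟹ Coinv_θ(ω_{−T₀} ∘ restrictRight s^𝔻 ∘ toNegForm ∘ φ) ≠ 0` and conversely (with the
  smoothness of the second block as a hypothesis).

HC_CM is NOT proved here and is proved only modulo the printed citations (2 remaining named inputs hLiu418, h413) until rung 0 closes.

## References
* [Kudla1994] S. Kudla, *Splitting metaplectic covers of dual reductive pairs*, Israel J. Math. 87 (1994), §2, §3 Thm. 3.1.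
* [GelbartRogawski1991] S. Gelbart, J. Rogawski, Invent. Math. 105 (1991), §3.1 Prop. 3.1.1 p. 455 L1–3 (undoubling).
* [MoeglinVignerasWaldspurger1987] C. Mœglin, M.-F. Vignéras, J.-L. Waldspurger, LNM 1291 (1987), Chap. 2 II.1 Rem. (6).
* [HarrisKudlaSweet1996] M. Harris, S. Kudla, W. Sweet, J. AMS 9 (1996), §3 (doubling see-saw).
-/

set_option autoImplicit false

noncomputable section

open scoped Matrix TensorProduct
open NumberField IsDedekindDomain MeasureTheory Matrix
open Literature.RepresentationTheory Literature.RepresentationTheory.HeisenbergGroup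
open Literature.NumberTheory.Automorphic Literature.NumberTheory.Automorphic.UnitaryGroup
open Literature.NumberTheory.GaloisRepresentations Literature.RepresentationTheory.HarrisKudlaSweet1996

namespace Literature.NumberTheory.GelbartRogawski1991.UnitaryDualPair.LocalSplitting

/-! ## §0 `undoubleLoc = BlockSum.restrictLeft` along `T^𝔻 = T₀ ⊕ᶠ (−T₀)` -/

section Bridge

variable (F : Type) [Field F] [NumberField F] (E : Type) [Field E] [NumberField E] [Algebra F E]
  [Algebra.IsQuadraticExtension F E] (c : E ≃ₐ[F] E)
  {δ : E} (hcδ : c δ = -δ) (hδ : δ ≠ 0) {d : F} (hd : δ * δ = algebraMap F E d)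
  (v : HeightOneSpectrum (𝓞 F)) (n : ℕ) {T₀ : Matrix (Fin n) (Fin n) F} (hT₀ : T₀.IsSymm) (hT₀d : IsUnit T₀.det)
  {J : Matrix (Fin n) (Fin n) E} (hJ : J = T₀.map (algebraMap F E))
  {JD : Matrix (Fin (n + n)) (Fin (n + n)) E} (hJD : JD = (gramD F n T₀).map (algebraMap F E))

omit [Algebra.IsQuadraticExtension F E] in
/-- the two block embeddings `g ↦ g ⊕ 1` of the tree agree (★ `inlLoc` of `LocalUnitaryUndoubling`, ★ `BlockSum.inlLoc`).
[cite: Kudla1994, §2 (doubled space, Siegel parabolic)] -/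
theorem inlLoc_eq_blockSum_inlLoc (g : localPi E c n J v) :
    inlLoc F E c v n hJ hJD g = BlockSum.inlLoc F E c v n n hJ (hJD_finSum F E n hJD) g := by
  refine Subtype.ext (funext fun w => ?_)
  rw [inlLoc_apply, BlockSum.inlLoc_apply]

variable (s : localPi E c (n + n) JD v →* LocalMp F (n + n) (gramD F n T₀) v)
  (hs : ∀ h, MpPsi.proj _ (s h) = iota F E c (n + n) hcδ hδ hd (gramD F n T₀) (gramD_isSymm F n hT₀) hJD v h)

/-- **`undoubleLoc s = BlockSum.restrictLeft s`** (same projection `ι_v`, same operator by `⊠`-cancellation against `1_{𝒪_v^n}`).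
[cite: GelbartRogawski1991, §3.1 Prop. 3.1.1 p. 455 L1–3] [cite: MoeglinVignerasWaldspurger1987, Chap. 2 II.1 Rem. (6)] -/
theorem undoubleLoc_eq_restrictLeft :
    undoubleLoc F E c v n hJ hJD hcδ hδ hd hT₀ hT₀d s hs =
      BlockSum.restrictLeft F E c v n n hJ (hJD_finSum F E n hJD) hcδ hδ hd hT₀ hT₀.neg (isUnit_det_neg_of_isUnit F n hT₀d) s hs := by
  refine MonoidHom.ext fun g => Subtype.ext (Prod.ext ?_ (LinearEquiv.ext fun f₁ => ?_))
  · rw [← MpPsi.proj_apply, ← MpPsi.proj_apply, proj_undoubleLoc, BlockSum.proj_restrictLeft]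
  · -- `⊠`-cancellation against the non-zero `1_{𝒪^n}`
    have hne : unitVec F (Fin n) v ≠ 0 := fun h0 => by
      have h1 : ((unitVec F (Fin n) v : SchwartzBruhat (Fin n → v.adicCompletion F)) : (Fin n → v.adicCompletion F) → ℂ) 0 = 1 :=
        unitVec_apply_of_mem fun i _ => (v.adicCompletionIntegers F).zero_mem
      rw [h0, ZeroMemClass.coe_zero, Pi.zero_apply] at h1
      exact zero_ne_one h1
    refine boxSB_left_cancel (v.adicCompletion F) (e₂ n) hne ?_
    have h1 := toRep_undoubleLoc_boxSB F E c v n hJ hJD hcδ hδ hd hT₀ hT₀d s hs g f₁ (unitVec F (Fin n) v)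
    have h2 := BlockSum.toRep_inlLoc_boxSB F E c v n n hJ (hJD_finSum F E n hJD) hcδ hδ hd hT₀ hT₀.neg (isUnit_det_neg_of_isUnit F n hT₀d)
      s hs g f₁ (unitVec F (Fin n) v)
    have h3 := congrArg (fun x : localPi E c (n + n) JD v =>
      MpPsi.toRep (localSchrodinger F (n + n) (gramD F n T₀) v) (s x) (boxSB (v.adicCompletion F) (e₂ n) f₁ (unitVec F (Fin n) v)))
      (inlLoc_eq_blockSum_inlLoc F E c v n hJ hJD g)
    exact h1.symm.trans (h3.trans h2)

end Bridge

/-! ## §1 (D) for `localSplittingCMWith` -/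

section CM

variable (L : Type) [Field L] [NumberField L] [IsCMField L] (v : HeightOneSpectrum (𝓞 (maximalRealSubfield L)))
  [MeasurableSpace (v.adicCompletion (maximalRealSubfield L))] [BorelSpace (v.adicCompletion (maximalRealSubfield L))]
  (μ : Measure (v.adicCompletion (maximalRealSubfield L))) [μ.IsAddHaarMeasure]
  (n : ℕ) {T₀ : Matrix (Fin n) (Fin n) (maximalRealSubfield L)} (hT₀ : T₀.IsSymm) (hT₀d : IsUnit T₀.det)
  (χ : HeckeCharacter L) (hχ : IsSplittingChar L 1 χ)
  (m₀ : LocalMp (maximalRealSubfield L) (n + n) (gramD (maximalRealSubfield L) n T₀) v)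
  (hm₀ : (deltaLagrangian (maximalRealSubfield L) v n).map (toLin (maximalRealSubfield L) v (MpPsi.proj _ m₀)) =
    lagrangianY (maximalRealSubfield L) (n + n) v)
  {J : Matrix (Fin n) (Fin n) L} (hJ : J = T₀.map (algebraMap (maximalRealSubfield L) L))
  {J' : Matrix (Fin n) (Fin n) L} (hJ' : J' = (-T₀).map (algebraMap (maximalRealSubfield L) L))
  {A : Type*} [Group A] [TopologicalSpace A] [IsTopologicalGroup A] [CompactSpace A]

/-- `localSplittingCMWith = BlockSum.restrictLeft s^𝔻` (★ `localSplittingCMWith = undoubleLoc s^𝔻` by definition, §0).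
[cite: GelbartRogawski1991, §3.1 Prop. 3.1.1 p. 455 L1–3] -/
theorem localSplittingCMWith_eq_restrictLeft :
    localSplittingCMWith L n hT₀ hT₀d hJ χ hχ v μ =
      BlockSum.restrictLeft (maximalRealSubfield L) L (IsCMField.complexConj L) v n n hJ
        (hJD_finSum (maximalRealSubfield L) L n rfl) (complexConj_imagUnit L) (imagUnit_ne_zero L) (imagUnit_mul_self L)
        hT₀ hT₀.neg (isUnit_det_neg_of_isUnit (maximalRealSubfield L) n hT₀d)
        ((localSplittingDatumCM L v μ n hT₀ hT₀d rfl χ hχ).localSplitting)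
        ((localSplittingDatumCM L v μ n hT₀ hT₀d rfl χ hχ).proj_localSplitting) :=
  undoubleLoc_eq_restrictLeft (maximalRealSubfield L) L (IsCMField.complexConj L) (complexConj_imagUnit L) (imagUnit_ne_zero L)
    (imagUnit_mul_self L) v n hT₀ hT₀d hJ rfl _ _

include hm₀ in
set_option maxHeartbeats 4000000 in -- the doubled CM datum's telescope (as in ★ `LocalDoubledBlockTypesDuality`)
/-- **(D), first block in the `localSplittingCMWith` currency ⇒ second block.**  `A` compact, `φ : A →* U(T₀⊗1)(L⁺_v)` CONTINUOUS,
characters `η θ : A →* ℂˣ` with `η(a)·θ(a) = e(φ a)` and `ker η` open: if the `η`-coinvariants of `ω_{T₀} ∘ localSplittingCMWith ∘ φ` are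
non-zero then so are the `θ`-coinvariants of the second block `ω_{−T₀} ∘ restrictRight s^𝔻 ∘ toNegForm ∘ φ`.
[cite: Kudla1994, §3 Thm. 3.1] [cite: HarrisKudlaSweet1996, §3] -/
theorem nontrivial_coinv_negBlock_of_nontrivial_coinv_localSplittingCMWith (φ : A →* localPi L (IsCMField.complexConj L) n J v)
    (hφ : Continuous φ) (η θ : A →* ℂˣ)
    (hηθ : ∀ a, ((η a : ℂˣ) : ℂ) * ((θ a : ℂˣ) : ℂ) =
      (((chiDet (maximalRealSubfield L) L (IsCMField.complexConj L) v n
            (fun w' : PlacesOver L v => (χ.localComponent w'.1)⁻¹)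
            (diagD (maximalRealSubfield L) L (IsCMField.complexConj L) v n hJ hJ' rfl (φ a)))⁻¹ : ℂˣ) : ℂ) *
        ((∏ w' : PlacesOver L v,
            Real.sqrt ‖detDelta (maximalRealSubfield L) L (IsCMField.complexConj L) v n w'
              (diagD (maximalRealSubfield L) L (IsCMField.complexConj L) v n hJ hJ' rfl (φ a))‖ : ℝ) : ℂ))
    (hη : IsOpen (η.ker : Set A))
    (hnt : Nontrivial (TwistedCoinv.Coinv (((MpPsi.toRep (localSchrodinger (maximalRealSubfield L) n T₀ v)).comp
      (localSplittingCMWith L n hT₀ hT₀d hJ χ hχ v μ)).comp φ) η)) :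
    Nontrivial (TwistedCoinv.Coinv (((MpPsi.toRep (localSchrodinger (maximalRealSubfield L) n (-T₀) v)).comp
      (BlockSum.restrictRight (maximalRealSubfield L) L (IsCMField.complexConj L) v n n hJ'
        (hJD_finSum (maximalRealSubfield L) L n rfl) (complexConj_imagUnit L) (imagUnit_ne_zero L) (imagUnit_mul_self L)
        hT₀ hT₀.neg hT₀d
        ((localSplittingDatumCM L v μ n hT₀ hT₀d rfl χ hχ).localSplitting)
        ((localSplittingDatumCM L v μ n hT₀ hT₀d rfl χ hχ).proj_localSplitting))).comp
      ((toNegForm (maximalRealSubfield L) L (IsCMField.complexConj L) v n hJ hJ').toMonoidHom.comp φ)) θ) := by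
  have hsm : Representation.IsSmooth (((MpPsi.toRep (localSchrodinger (maximalRealSubfield L) n T₀ v)).comp
      (localSplittingCMWith L n hT₀ hT₀d hJ χ hχ v μ)).comp φ) := fun f =>
    (isSmooth_localSplittingCMWith L n hT₀ hT₀d hJ χ hχ v μ f).preimage hφ
  rw [localSplittingCMWith_eq_restrictLeft L v μ n hT₀ hT₀d χ hχ hJ] at hsm hnt
  exact nontrivial_coinv_right_of_nontrivial_coinv_left L v μ n hT₀ hT₀d χ hχ m₀ hm₀ hJ hJ' φ η θ hηθ hη hsm hnt

include hm₀ in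
set_option maxHeartbeats 4000000 in -- the doubled CM datum's telescope (as in ★ `LocalDoubledBlockTypesDuality`)
/-- **(D), second block ⇒ first block in the `localSplittingCMWith` currency.**  With the smoothness of the second block as a hypothesis
(`hsm`), `ker η` open and `η·θ = e ∘ φ`: `Coinv_η(ω_{−T₀} ∘ restrictRight s^𝔻 ∘ toNegForm ∘ φ) ≠ 0 ⟹ Coinv_θ(ω_{T₀} ∘ localSplittingCMWith ∘ φ) ≠ 0`.
[cite: Kudla1994, §3 Thm. 3.1] [cite: HarrisKudlaSweet1996, §3] -/
theorem nontrivial_coinv_localSplittingCMWith_of_nontrivial_coinv_negBlock (φ : A →* localPi L (IsCMField.complexConj L) n J v)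
    (η θ : A →* ℂˣ)
    (hηθ : ∀ a, ((η a : ℂˣ) : ℂ) * ((θ a : ℂˣ) : ℂ) =
      (((chiDet (maximalRealSubfield L) L (IsCMField.complexConj L) v n
            (fun w' : PlacesOver L v => (χ.localComponent w'.1)⁻¹)
            (diagD (maximalRealSubfield L) L (IsCMField.complexConj L) v n hJ hJ' rfl (φ a)))⁻¹ : ℂˣ) : ℂ) *
        ((∏ w' : PlacesOver L v,
            Real.sqrt ‖detDelta (maximalRealSubfield L) L (IsCMField.complexConj L) v n w'
              (diagD (maximalRealSubfield L) L (IsCMField.complexConj L) v n hJ hJ' rfl (φ a))‖ : ℝ) : ℂ))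
    (hη : IsOpen (η.ker : Set A))
    (hsm : Representation.IsSmooth ((((MpPsi.toRep (localSchrodinger (maximalRealSubfield L) n (-T₀) v)).comp
      (BlockSum.restrictRight (maximalRealSubfield L) L (IsCMField.complexConj L) v n n hJ'
        (hJD_finSum (maximalRealSubfield L) L n rfl) (complexConj_imagUnit L) (imagUnit_ne_zero L) (imagUnit_mul_self L)
        hT₀ hT₀.neg hT₀d
        ((localSplittingDatumCM L v μ n hT₀ hT₀d rfl χ hχ).localSplitting)
        ((localSplittingDatumCM L v μ n hT₀ hT₀d rfl χ hχ).proj_localSplitting))).comp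
      ((toNegForm (maximalRealSubfield L) L (IsCMField.complexConj L) v n hJ hJ').toMonoidHom.comp φ))))
    (hnt : Nontrivial (TwistedCoinv.Coinv (((MpPsi.toRep (localSchrodinger (maximalRealSubfield L) n (-T₀) v)).comp
      (BlockSum.restrictRight (maximalRealSubfield L) L (IsCMField.complexConj L) v n n hJ'
        (hJD_finSum (maximalRealSubfield L) L n rfl) (complexConj_imagUnit L) (imagUnit_ne_zero L) (imagUnit_mul_self L)
        hT₀ hT₀.neg hT₀d
        ((localSplittingDatumCM L v μ n hT₀ hT₀d rfl χ hχ).localSplitting)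
        ((localSplittingDatumCM L v μ n hT₀ hT₀d rfl χ hχ).proj_localSplitting))).comp
      ((toNegForm (maximalRealSubfield L) L (IsCMField.complexConj L) v n hJ hJ').toMonoidHom.comp φ)) η)) :
    Nontrivial (TwistedCoinv.Coinv (((MpPsi.toRep (localSchrodinger (maximalRealSubfield L) n T₀ v)).comp
      (localSplittingCMWith L n hT₀ hT₀d hJ χ hχ v μ)).comp φ) θ) := by
  rw [localSplittingCMWith_eq_restrictLeft L v μ n hT₀ hT₀d χ hχ hJ]
  exact nontrivial_coinv_left_of_nontrivial_coinv_right L v μ n hT₀ hT₀d χ hχ m₀ hm₀ hJ hJ' φ η θ hηθ hη hsm hnt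

end CM

end Literature.NumberTheory.GelbartRogawski1991.UnitaryDualPair.LocalSplitting

end
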